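import Summits.QuantumFields.YangMills.Theorems.BalabanUVNodesN21GappedTopPairReading13CoPH

/-!
# N21 (NE7c) · THE DOUBLY-GAPPED READING `crGap2₁₃VAt K₀ jcut ρ ρ′ n₁ n₂`, part 2 — THE FACES: fibre sums, (R), `ShellWeightBound` (every field PROVED, (M1)-FREE, BOTH indicator
# families of the last 𝐓-step banded on BOTH sides of their cuts), `KeyedExtraction`, the N20 ∕ N19′ ∕ U4′ transfers — the four names the lane owner's reading-generic V1 knit
# reads, at the doubly-gapped reading

WIDTH SEAT `pub-ymgap-dag-n21-w7` (g2), node N21 = NE7c (NOT PRINTED; NOT proved at print's fixed thresholds); lane K3⁸ `SpineGivenEndpointR13SepCoPHV`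
(stmt-QuantumFields-27366, `--supports … --as helper`; COUNT-NEUTRAL).  THEOREMS ONLY (0 `def`).  Imports part 1 `…GappedTopPairReading13CoPH` (§E3 `gap2ShellSum_selDepths_le`,
§E2 `sum_topTerm2AtLevel_eq_schemeZ_of_liveSel`, §E1 `topGap2ShellAtLevel_nonneg ∕ _le`; through it the reading's definition lane and the lane owner dag-n21-d's U6 road:
n20-d's canonical-weight transfers `shellWeightBound_wshInf ∕ relWeightBound_wInf ∕ core_deltaCan ∕ summable_deltaCan ∕ wInf_add_wshInf_lt_one`).  The READING twin of CLAIM-4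
(dag-n21-d g12, cell bus 2026-08-28 11:14Z: «V1 instantiates at `crGap2₁₃V` by ONE application the hour your reading + faces land»).

WHAT THIS FILE PROVES ([folklore] bookkeeping; every row displayed).
* §F1 fibre sums over the class set: `sum_classSet₁₃_gapWeight2A₁₃ ∕ B`, `sum_classSet₁₃_gapShell2A₁₃ ∕ B`; ★ E1∕E2 at the reading `sum_classSet₁₃_gapWeight2A₁₃_eq_schemeZ ∕ …B…`.
* §F2 ★★★ `shellWeightBound_carriersGap2₁₃` — `ShellWeightBound 1 (classSet₁₃ θ K₀ g₀) (gapWeight2A₁₃ …) (gapWeight2B₁₃ …) (gapShell2A₁₃ …) (gapShell2B₁₃ …)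
  (K ↦ 4(2L^m)⁴·(1∕(n₁ K+1) + 1∕(n₂ K+1)))`, every field PROVED; rows: the live-selector pin, (H-ζ), `0 ≤ ρ_K, ρ′_K ≤ 1`, both tops' `0 ≤ ε`, both old levels' `0 ≤ δ`,
  `Summable (K ↦ 1∕(n₁ K+1) + 1∕(n₂ K+1))`; ★★★ `shellWeightBound_crGap2₁₃VAt` (at the reading's own `l₀, T, A, B, shA, shB` and CANONICAL `Wsh`); ★★ `keyedExtraction_crGap2₁₃VAt`
  (THEOREM, every `g₀`); ★ `relWeightBound_crGap2₁₃VAt`, ★ `core_crGap2₁₃VAt`, `lt_one_crGap2₁₃VAt` (transfers from witnesses; the cores are the DOUBLY-GAPPED cores);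
  ★★ `keyedShellWeight_shape_crGap2₁₃V_of_rows` (the K3 stub-2 conjunct's ∀-shape at `crGap2₁₃V`, modulo the displayed rows).

HONEST FRAMING (binding).  Bookkeeping BY NAME; NO estimate of Bałaban's; (M1)-free ONLY at SELECTED relative letters of the two top-step indicator families — NE7c at print's FIXED
thresholds is NOT proved; the residual `ζ` ∕ (3.5), the ℝ-side and everything below the top step NOT re-lettered (LOCATED); the K3 skeleton's `PinnedAtLive` untouched; N20's
`RelWeightBound` and N19′'s core matching at the doubly-gapped carriers are HYPOTHESES of the transfers (witness form), NOT proved; the common-refinement comparison is the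
consumer's (n21-w2's junction files); no `Provisos₁₃CoPH` inhabitant claimed (K0⁷ open); N21 NOT discharged; K3⁸ NOT claimed; counts UNMOVED (typed 28∕28 · discharged 5∕27,
A 5∕28); never a count claim.  No `sorry`, no `axiom`, no `def`, no `instance`, no `notation`.  One finite four-torus programme at fixed `ε` — NOT ℝ⁴, NOT OS, NOT a mass gap,
NOT the Clay problem.
-/

noncomputable section

open scoped BigOperators
open Finset MeasureTheory

namespace Summit.QuantumFields.YangMills.Theorems.N21GappedTopPair13CoPH

open Literature.MathematicalPhysics.QuantumFieldTheory.Balaban1983to89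
open Literature.MathematicalPhysics.QuantumFieldTheory.Balaban1983to89.T4Continuum
open Literature.MathematicalPhysics.QuantumFieldTheory.Balaban1983to89.Node00
open YMDAG.UVSplit (SpineReading₁₃CoPH keyA₁₃ keyB₁₃ runA₁₃ runB₁₃ histA₁₃ histB₁₃ histA₁₃_zero histB₁₃_zero classSet₁₃ badClass₁₃)
open T4WeightBudget (RelWeightBound)
open T4IndicatorShell (ShellWeightBound)
open T4ContinuumYM4Torus (ForSmallCouplings)
open Summit.QuantumFields.BalabanUV.T4Continuum.Spine
open Summit.QuantumFields.YangMills.BalabanUVNodes.SpineCanonicalWeights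
open Summit.QuantumFields.YangMills.Theorems.N21StepWeightsPositivity (zetaOfRecord_nonneg)
open Summit.QuantumFields.YangMills.BalabanUVNodes.N19MGFFormAtRecordMass (sum_classWeightOfDatum₉_datumOfRecord₁₃CoPH_eq_schemeZ_of_ppSelLive)
open Summit.QuantumFields.YangMills.BalabanUVNodes.N19MGFFormAtRecord (wOfRecord₉_nonneg)
open Summit.QuantumFields.YangMills.Theorems.N21ShellSplitOfRecord13CoPH

section Faces2

variable {F : T4Family} {N : ℕ} [NeZero N]

/-! ## §F1 Fibre sums over the class set; E1 ∕ E2 at the reading -/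

/-- run A: the class-set sum of the doubly-gapped weights is the full sum of the pair-lettered terms at the selected middle letters. [bookkeeping] -/
theorem sum_classSet₁₃_gapWeight2A₁₃ (K₀ : ℕ) (θ : Stage13HParams F N) (hP : θ.Provisos₁₃CoPH F N) (g₀ : ℕ → ℝ) (os : List (ULoop F)) (ρ ρ' : ℕ → ℝ)
    (n₁ n₂ : ℕ → ℕ) (K : ℕ) (t : ℝ) :
    ∑ x ∈ classSet₁₃ θ K₀ g₀ K, gapWeight2A₁₃ θ hP K₀ g₀ os ρ ρ' n₁ n₂ K t x =
      ∑ s, topTerm2AtLevel F N θ.toStage9Params (datumOfRecord₁₃CoPH F N θ hP) g₀ os (runA₁₃ F K₀ g₀ K) (histA₁₃ θ K₀ g₀ K)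
        (cutGrid θ.ν (histA₁₃ θ K₀ g₀ K) (K₀ + K) (ρ K) (selDepthA2₁₃ θ hP K₀ g₀ os ρ (n₁ K) K t + 1))
        (bCutGrid θ.ν θ.A₁ (histA₁₃ θ K₀ g₀ K) (K₀ + K - 1) (ρ' K) (selDepthB2₁₃ θ hP K₀ g₀ os ρ' (n₂ K) K t + 1)) t (K₀ + K) s := by
  letI : ∀ Kc, DecidableEq (SiteSeqKey F Kc) := fun _ => Classical.decEq _
  exact Finset.sum_fiberwise_of_maps_to (s := Finset.univ) (t := classSet₁₃ θ K₀ g₀ K) (g := keyA₁₃ θ K₀ g₀ K)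
    (fun s _ => Finset.mem_union_left _ (Finset.mem_image_of_mem _ (Finset.mem_univ s))) _

/-- run B: the same along `keyB₁₃`. [bookkeeping] -/
theorem sum_classSet₁₃_gapWeight2B₁₃ (K₀ : ℕ) (θ : Stage13HParams F N) (hP : θ.Provisos₁₃CoPH F N) (g₀ : ℕ → ℝ) (os : List (ULoop F)) (ρ ρ' : ℕ → ℝ)
    (n₁ n₂ : ℕ → ℕ) (K : ℕ) (t : ℝ) :
    ∑ x ∈ classSet₁₃ θ K₀ g₀ K, gapWeight2B₁₃ θ hP K₀ g₀ os ρ ρ' n₁ n₂ K t x =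
      ∑ s', topTerm2AtLevel F N θ.toStage9Params (datumOfRecord₁₃CoPH F N θ hP) g₀ os (runB₁₃ F K₀ g₀ K) (histB₁₃ θ K₀ g₀ K)
        (cutGrid θ.ν (histB₁₃ θ K₀ g₀ K) (K₀ + K + 1) (ρ K) (selDepthA2₁₃ θ hP K₀ g₀ os ρ (n₁ K) K t + 1))
        (bCutGrid θ.ν θ.A₁ (histB₁₃ θ K₀ g₀ K) (K₀ + K) (ρ' K) (selDepthB2₁₃ θ hP K₀ g₀ os ρ' (n₂ K) K t + 1)) t (K₀ + K + 1) s' := by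
  letI : ∀ Kc, DecidableEq (SiteSeqKey F Kc) := fun _ => Classical.decEq _
  exact Finset.sum_fiberwise_of_maps_to (s := Finset.univ) (t := classSet₁₃ θ K₀ g₀ K) (g := keyB₁₃ θ K₀ g₀ K)
    (fun s' _ => Finset.mem_union_right _ (Finset.mem_image_of_mem _ (Finset.mem_univ s'))) _

/-- run A: the class-set sum of the two-collar shell parts is the run's two-collar shell mass at the selected depth pair. [bookkeeping] -/
theorem sum_classSet₁₃_gapShell2A₁₃ (K₀ : ℕ) (θ : Stage13HParams F N) (hP : θ.Provisos₁₃CoPH F N) (g₀ : ℕ → ℝ) (os : List (ULoop F)) (ρ ρ' : ℕ → ℝ)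
    (n₁ n₂ : ℕ → ℕ) (K : ℕ) (t : ℝ) :
    ∑ x ∈ classSet₁₃ θ K₀ g₀ K, gapShell2A₁₃ θ hP K₀ g₀ os ρ ρ' n₁ n₂ K t x =
      gap2ShellSumA₁₃ θ hP K₀ g₀ os ρ ρ' K (selDepthA2₁₃ θ hP K₀ g₀ os ρ (n₁ K) K t) (selDepthB2₁₃ θ hP K₀ g₀ os ρ' (n₂ K) K t) t := by
  letI : ∀ Kc, DecidableEq (SiteSeqKey F Kc) := fun _ => Classical.decEq _
  exact Finset.sum_fiberwise_of_maps_to (s := Finset.univ) (t := classSet₁₃ θ K₀ g₀ K) (g := keyA₁₃ θ K₀ g₀ K)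
    (fun s _ => Finset.mem_union_left _ (Finset.mem_image_of_mem _ (Finset.mem_univ s))) _

/-- run B: the same. [bookkeeping] -/
theorem sum_classSet₁₃_gapShell2B₁₃ (K₀ : ℕ) (θ : Stage13HParams F N) (hP : θ.Provisos₁₃CoPH F N) (g₀ : ℕ → ℝ) (os : List (ULoop F)) (ρ ρ' : ℕ → ℝ)
    (n₁ n₂ : ℕ → ℕ) (K : ℕ) (t : ℝ) :
    ∑ x ∈ classSet₁₃ θ K₀ g₀ K, gapShell2B₁₃ θ hP K₀ g₀ os ρ ρ' n₁ n₂ K t x =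
      gap2ShellSumB₁₃ θ hP K₀ g₀ os ρ ρ' K (selDepthA2₁₃ θ hP K₀ g₀ os ρ (n₁ K) K t) (selDepthB2₁₃ θ hP K₀ g₀ os ρ' (n₂ K) K t) t := by
  letI : ∀ Kc, DecidableEq (SiteSeqKey F Kc) := fun _ => Classical.decEq _
  exact Finset.sum_fiberwise_of_maps_to (s := Finset.univ) (t := classSet₁₃ θ K₀ g₀ K) (g := keyB₁₃ θ K₀ g₀ K)
    (fun s' _ => Finset.mem_union_right _ (Finset.mem_image_of_mem _ (Finset.mem_univ s'))) _

/-- ★ **E1 AT THE DOUBLY-GAPPED READING**: run A's doubly-gapped class weights sum over the class set to the run's dressed partition function (rows `hsel`, (H-ζ)). [bookkeeping] -/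
theorem sum_classSet₁₃_gapWeight2A₁₃_eq_schemeZ (K₀ : ℕ) (θ : Stage13HParams F N) (hP : θ.Provisos₁₃CoPH F N) (g₀ : ℕ → ℝ) (os : List (ULoop F))
    (E : B12.RunParams → ℝ) (hsel : θ.ppSel = ppSelLiveOfRecord F N θ.ν θ.τ9 E (wOfRecord₉ F N θ.toStage9Params)) (hζm : ZetaMeasurable F N θ.ζ)
    (ρ ρ' : ℕ → ℝ) (n₁ n₂ : ℕ → ℕ) (K : ℕ) (t : ℝ) :
    ∑ x ∈ classSet₁₃ θ K₀ g₀ K, gapWeight2A₁₃ θ hP K₀ g₀ os ρ ρ' n₁ n₂ K t x = T4GenFunBounds.schemeZ ((datumOfRecord₁₃CoPH F N θ hP).scheme g₀) os (K₀ + K) t := by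
  rw [sum_classSet₁₃_gapWeight2A₁₃]
  exact sum_topTerm2AtLevel_eq_schemeZ_of_liveSel θ hP E hsel hζm g₀ os (p := runA₁₃ F K₀ g₀ K) (histA₁₃_zero θ K₀ g₀ K) _ _ t (K₀ + K) rfl

/-- ★ **E2 AT THE DOUBLY-GAPPED READING**: run B's. [bookkeeping] -/
theorem sum_classSet₁₃_gapWeight2B₁₃_eq_schemeZ (K₀ : ℕ) (θ : Stage13HParams F N) (hP : θ.Provisos₁₃CoPH F N) (g₀ : ℕ → ℝ) (os : List (ULoop F))
    (E : B12.RunParams → ℝ) (hsel : θ.ppSel = ppSelLiveOfRecord F N θ.ν θ.τ9 E (wOfRecord₉ F N θ.toStage9Params)) (hζm : ZetaMeasurable F N θ.ζ)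
    (ρ ρ' : ℕ → ℝ) (n₁ n₂ : ℕ → ℕ) (K : ℕ) (t : ℝ) :
    ∑ x ∈ classSet₁₃ θ K₀ g₀ K, gapWeight2B₁₃ θ hP K₀ g₀ os ρ ρ' n₁ n₂ K t x = T4GenFunBounds.schemeZ ((datumOfRecord₁₃CoPH F N θ hP).scheme g₀) os (K₀ + K + 1) t := by
  rw [sum_classSet₁₃_gapWeight2B₁₃]
  exact sum_topTerm2AtLevel_eq_schemeZ_of_liveSel θ hP E hsel hζm g₀ os (p := runB₁₃ F K₀ g₀ K) (histB₁₃_zero θ K₀ g₀ K) _ _ t (K₀ + K + 1) rfl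

/-! ## §F2 `ShellWeightBound` at the doubly-gapped carriers and at the reading; `KeyedExtraction`; transfers -/

/-- ★★★ **N21's OUTPUT SHAPE AT THE DOUBLY-GAPPED CARRIERS — BOTH INDICATOR FAMILIES OF THE LAST 𝐓-STEP, BOTH SIDES OF BOTH CUTS BANDED, (M1)-FREE.**  At a `CoPH`-keyed Stage-13
tuple on the live-selector line (`hsel`), under (H-ζ), with the dial rows `0 ≤ ρ_K, ρ′_K ≤ 1`, both tops' `0 ≤ ε`, both old levels' `0 ≤ δ` (every `K`) and
`Summable (K ↦ 1∕(n₁ K+1) + 1∕(n₂ K+1))`: `ShellWeightBound 1 (classSet₁₃ θ K₀ g₀) (gapWeight2A₁₃ …) (gapWeight2B₁₃ …) (gapShell2A₁₃ …) (gapShell2B₁₃ …)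
(K ↦ 4(2L^m)⁴·(1∕(n₁ K+1) + 1∕(n₂ K+1)))` — every field PROVED; NO anti-concentration, NO estimate of Bałaban's. [bookkeeping] -/
theorem shellWeightBound_carriersGap2₁₃ (K₀ : ℕ) (θ : Stage13HParams F N) (hP : θ.Provisos₁₃CoPH F N) (g₀ : ℕ → ℝ) (os : List (ULoop F)) (E : B12.RunParams → ℝ)
    (hsel : θ.ppSel = ppSelLiveOfRecord F N θ.ν θ.τ9 E (wOfRecord₉ F N θ.toStage9Params)) (hζm : ZetaMeasurable F N θ.ζ)
    {ρ ρ' : ℕ → ℝ} {n₁ n₂ : ℕ → ℕ} (hρ0 : ∀ K, 0 ≤ ρ K) (hρ1 : ∀ K, ρ K ≤ 1) (hρ'0 : ∀ K, 0 ≤ ρ' K) (hρ'1 : ∀ K, ρ' K ≤ 1)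
    (hεA : ∀ K, 0 ≤ epsOfRecord θ.ν (histA₁₃ θ K₀ g₀ K) (K₀ + K)) (hεB : ∀ K, 0 ≤ epsOfRecord θ.ν (histB₁₃ θ K₀ g₀ K) (K₀ + K + 1))
    (hδA : ∀ K, 0 ≤ deltaOfRecord θ.ν (histA₁₃ θ K₀ g₀ K) (K₀ + K - 1) θ.A₁) (hδB : ∀ K, 0 ≤ deltaOfRecord θ.ν (histB₁₃ θ K₀ g₀ K) (K₀ + K) θ.A₁)
    (hn : Summable (fun K => 1 / ((n₁ K : ℝ) + 1) + 1 / ((n₂ K : ℝ) + 1))) :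
    ShellWeightBound 1 (classSet₁₃ θ K₀ g₀) (gapWeight2A₁₃ θ hP K₀ g₀ os ρ ρ' n₁ n₂) (gapWeight2B₁₃ θ hP K₀ g₀ os ρ ρ' n₁ n₂) (gapShell2A₁₃ θ hP K₀ g₀ os ρ ρ' n₁ n₂)
      (gapShell2B₁₃ θ hP K₀ g₀ os ρ ρ' n₁ n₂) (fun K => 4 * (2 * (F.L : ℝ) ^ F.m) ^ 4 * (1 / ((n₁ K : ℝ) + 1) + 1 / ((n₂ K : ℝ) + 1))) := by
  have hζ0 : ∀ p g k s Pl Ql RS U V', 0 ≤ θ.ζ p g k s Pl Ql RS U V' :=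
    fun p g k s Pl Ql RS U V' => zetaOfRecord_nonneg F N θ.ν θ.τ9.M hP.zetaUnity hP.zetaAbs p g k s Pl Ql RS U V'
  have hU : LocalBgMeasurable F N θ.ν := localBgMeasurable F N θ.ν
  have hD : (datumOfRecord₁₃CoPH F N θ hP).AvgMeasurable := (isPrintedAveraged_datumOfRecord₁₃CoPH F N θ hP).avgMeasurable
  have hνbar : 0 ≤ 4 * (2 * (F.L : ℝ) ^ F.m) ^ 4 := by positivity
  have hconst : ∀ K, 4 * (2 * (F.L : ℝ) ^ F.m) ^ 4 * (1 / (n₁ K + 1 : ℕ) + 1 / (n₂ K + 1 : ℕ)) =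
      4 * (2 * (F.L : ℝ) ^ F.m) ^ 4 * (1 / ((n₁ K : ℝ) + 1) + 1 / ((n₂ K : ℝ) + 1)) := fun K => by push_cast; ring
  have hθA : ∀ K i, cutGrid θ.ν (histA₁₃ θ K₀ g₀ K) (K₀ + K) (ρ K) (i + 1) ≤ cutGrid θ.ν (histA₁₃ θ K₀ g₀ K) (K₀ + K) (ρ K) i :=
    fun K i => cutGrid_succ_le_of_nonneg θ.ν (K₀ + K) (hεA K) (hρ0 K) (hρ1 K) i
  have hθB : ∀ K i, cutGrid θ.ν (histB₁₃ θ K₀ g₀ K) (K₀ + K + 1) (ρ K) (i + 1) ≤ cutGrid θ.ν (histB₁₃ θ K₀ g₀ K) (K₀ + K + 1) (ρ K) i :=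
    fun K i => cutGrid_succ_le_of_nonneg θ.ν (K₀ + K + 1) (hεB K) (hρ0 K) (hρ1 K) i
  have hδ'A : ∀ K j, bCutGrid θ.ν θ.A₁ (histA₁₃ θ K₀ g₀ K) (K₀ + K - 1) (ρ' K) (j + 1) ≤ bCutGrid θ.ν θ.A₁ (histA₁₃ θ K₀ g₀ K) (K₀ + K - 1) (ρ' K) j :=
    fun K j => bCutGrid_succ_le_of_nonneg θ.ν θ.A₁ (histA₁₃ θ K₀ g₀ K) (K₀ + K - 1) (hδA K) (hρ'0 K) (hρ'1 K) j
  have hδ'B : ∀ K j, bCutGrid θ.ν θ.A₁ (histB₁₃ θ K₀ g₀ K) (K₀ + K) (ρ' K) (j + 1) ≤ bCutGrid θ.ν θ.A₁ (histB₁₃ θ K₀ g₀ K) (K₀ + K) (ρ' K) j :=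
    fun K j => bCutGrid_succ_le_of_nonneg θ.ν θ.A₁ (histB₁₃ θ K₀ g₀ K) (K₀ + K) (hδB K) (hρ'0 K) (hρ'1 K) j
  have hintA : ∀ K k, k < (runA₁₃ F K₀ g₀ K).K → ∀ s : SeqOfRecord F θ.ν θ.τ9.M (histA₁₃ θ K₀ g₀ K) (runA₁₃ F K₀ g₀ K).K k, ∀ t : ℝ,
      Integrable (fun U => chiSeqOfRecord F N θ.ν θ.τ9.M (histA₁₃ θ K₀ g₀ K) (runA₁₃ F K₀ g₀ K).K k s U *
        dressedSlotsOfDatum₉ F N θ.toStage9Params (datumOfRecord₁₃CoPH F N θ hP) g₀ os t (runA₁₃ F K₀ g₀ K) (histA₁₃ θ K₀ g₀ K) k s U)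
        (fieldMeasure (F.P (runA₁₃ F K₀ g₀ K).K) k (SU N)) :=
    fun K k _ s t => integrable_chi_mul_dressedSlots_of_ppSelLive θ.toStage9Params E hsel hU hζm hζ0 hP.zetaAbs _ hD g₀ os (histA₁₃_zero θ K₀ g₀ K) t k s
  have hintB : ∀ K k, k < (runB₁₃ F K₀ g₀ K).K → ∀ s : SeqOfRecord F θ.ν θ.τ9.M (histB₁₃ θ K₀ g₀ K) (runB₁₃ F K₀ g₀ K).K k, ∀ t : ℝ,
      Integrable (fun U => chiSeqOfRecord F N θ.ν θ.τ9.M (histB₁₃ θ K₀ g₀ K) (runB₁₃ F K₀ g₀ K).K k s U *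
        dressedSlotsOfDatum₉ F N θ.toStage9Params (datumOfRecord₁₃CoPH F N θ hP) g₀ os t (runB₁₃ F K₀ g₀ K) (histB₁₃ θ K₀ g₀ K) k s U)
        (fieldMeasure (F.P (runB₁₃ F K₀ g₀ K).K) k (SU N)) :=
    fun K k _ s t => integrable_chi_mul_dressedSlots_of_ppSelLive θ.toStage9Params E hsel hU hζm hζ0 hP.zetaAbs _ hD g₀ os (histB₁₃_zero θ K₀ g₀ K) t k s
  letI : ∀ Kc, DecidableEq (SiteSeqKey F Kc) := fun _ => Classical.decEq _
  refine
    { nonneg := fun K => mul_nonneg hνbar (by positivity)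
      summable := hn.mul_left _
      sh_nonneg_left := fun K t _ x _ => Finset.sum_nonneg fun s _ =>
        topGap2ShellAtLevel_nonneg F N θ.toStage9Params (datumOfRecord₁₃CoPH F N θ hP) g₀ os (runA₁₃ F K₀ g₀ K) (histA₁₃ θ K₀ g₀ K) hζ0 hζm hP.zetaAbs
          (hθA K _) (hθA K _) (hδ'A K _) (hδ'A K _) t (fun k hk s => hintA K k hk s t) (K₀ + K) rfl s
      sh_le_left := fun K t _ x _ => Finset.sum_le_sum fun s _ =>
        topGap2ShellAtLevel_le F N θ.toStage9Params (datumOfRecord₁₃CoPH F N θ hP) g₀ os (runA₁₃ F K₀ g₀ K) (histA₁₃ θ K₀ g₀ K) hζ0 _ _ _ _ _ _ t (K₀ + K) s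
      sh_nonneg_right := fun K t _ x _ => Finset.sum_nonneg fun s' _ =>
        topGap2ShellAtLevel_nonneg F N θ.toStage9Params (datumOfRecord₁₃CoPH F N θ hP) g₀ os (runB₁₃ F K₀ g₀ K) (histB₁₃ θ K₀ g₀ K) hζ0 hζm hP.zetaAbs
          (hθB K _) (hθB K _) (hδ'B K _) (hδ'B K _) t (fun k hk s => hintB K k hk s t) (K₀ + K + 1) rfl s'
      sh_le_right := fun K t _ x _ => Finset.sum_le_sum fun s' _ =>
        topGap2ShellAtLevel_le F N θ.toStage9Params (datumOfRecord₁₃CoPH F N θ hP) g₀ os (runB₁₃ F K₀ g₀ K) (histB₁₃ θ K₀ g₀ K) hζ0 _ _ _ _ _ _ t (K₀ + K + 1) s'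
      left := fun K t _ => ?_
      right := fun K t _ => ?_ }
  · rw [sum_classSet₁₃_gapShell2A₁₃, sum_classSet₁₃_gapWeight2A₁₃_eq_schemeZ K₀ θ hP g₀ os E hsel hζm, ← hconst K]
    exact (gap2ShellSum_selDepths_le K₀ θ hP g₀ os E hsel hζm hρ0 hρ1 hρ'0 hρ'1 (n₁ K) (n₂ K) K t (hεA K) (hεB K) (hδA K) (hδB K)).1
  · rw [sum_classSet₁₃_gapShell2B₁₃, sum_classSet₁₃_gapWeight2B₁₃_eq_schemeZ K₀ θ hP g₀ os E hsel hζm, ← hconst K]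
    exact (gap2ShellSum_selDepths_le K₀ θ hP g₀ os E hsel hζm hρ0 hρ1 hρ'0 hρ'1 (n₁ K) (n₂ K) K t (hεA K) (hεB K) (hδA K) (hδB K)).2

/-- ★★★ **`KeyedShellWeight` AT THE DOUBLY-GAPPED READING, (M1)-FREE**: on the live-selector line, under (H-ζ), with the dial rows, the tops' `0 ≤ ε` and the old levels' `0 ≤ δ`
and `Σ_K (1∕(n₁ K+1) + 1∕(n₂ K+1)) < ∞` read at the tuple: `ShellWeightBound` AT `crGap2₁₃VAt N K₀ jcut ρ ρ′ n₁ n₂` — its `l₀, T, A, B, shA, shB` and its CANONICAL `Wsh` (n20-d's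
`shellWeightBound_wshInf`).  `jcut` is not read. [bookkeeping] -/
theorem shellWeightBound_crGap2₁₃VAt (K₀ : ℕ) (jcut : ℕ → ℕ) (ρ ρ' : WidthLetter₁₃CoPH N) (n₁ n₂ : DepthLetter₁₃CoPH N) (θ : Stage13HParams F N)
    (hP : θ.Provisos₁₃CoPH F N) (g₀ : ℕ → ℝ) (os : List (ULoop F)) (E : B12.RunParams → ℝ)
    (hsel : θ.ppSel = ppSelLiveOfRecord F N θ.ν θ.τ9 E (wOfRecord₉ F N θ.toStage9Params)) (hζm : ZetaMeasurable F N θ.ζ)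
    (hρ0 : ∀ K, 0 ≤ ρ F θ hP g₀ os K) (hρ1 : ∀ K, ρ F θ hP g₀ os K ≤ 1) (hρ'0 : ∀ K, 0 ≤ ρ' F θ hP g₀ os K) (hρ'1 : ∀ K, ρ' F θ hP g₀ os K ≤ 1)
    (hεA : ∀ K, 0 ≤ epsOfRecord θ.ν (histA₁₃ θ K₀ g₀ K) (K₀ + K)) (hεB : ∀ K, 0 ≤ epsOfRecord θ.ν (histB₁₃ θ K₀ g₀ K) (K₀ + K + 1))
    (hδA : ∀ K, 0 ≤ deltaOfRecord θ.ν (histA₁₃ θ K₀ g₀ K) (K₀ + K - 1) θ.A₁) (hδB : ∀ K, 0 ≤ deltaOfRecord θ.ν (histB₁₃ θ K₀ g₀ K) (K₀ + K) θ.A₁)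
    (hn : Summable (fun K => 1 / ((n₁ F θ hP g₀ os K : ℝ) + 1) + 1 / ((n₂ F θ hP g₀ os K : ℝ) + 1))) :
    ShellWeightBound (crGap2₁₃VAt N K₀ jcut ρ ρ' n₁ n₂ F θ hP g₀ os).l₀ (crGap2₁₃VAt N K₀ jcut ρ ρ' n₁ n₂ F θ hP g₀ os).T
      (crGap2₁₃VAt N K₀ jcut ρ ρ' n₁ n₂ F θ hP g₀ os).A (crGap2₁₃VAt N K₀ jcut ρ ρ' n₁ n₂ F θ hP g₀ os).B (crGap2₁₃VAt N K₀ jcut ρ ρ' n₁ n₂ F θ hP g₀ os).shA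
      (crGap2₁₃VAt N K₀ jcut ρ ρ' n₁ n₂ F θ hP g₀ os).shB (crGap2₁₃VAt N K₀ jcut ρ ρ' n₁ n₂ F θ hP g₀ os).Wsh :=
  shellWeightBound_wshInf (shellWeightBound_carriersGap2₁₃ K₀ θ hP g₀ os E hsel hζm hρ0 hρ1 hρ'0 hρ'1 hεA hεB hδA hδB hn)

/-- ★★ **`KeyedExtraction` AT THE DOUBLY-GAPPED READING IS A THEOREM** (the K3 skeleton's shape): `0 < l₀`, `0 < vol`, and E1 ∕ E2 for EVERY `g₀` (a fortiori `ForSmallCouplings`) —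
rows `hsel`, (H-ζ). [bookkeeping] -/
theorem keyedExtraction_crGap2₁₃VAt (K₀ : ℕ) (jcut : ℕ → ℕ) (ρ ρ' : WidthLetter₁₃CoPH N) (n₁ n₂ : DepthLetter₁₃CoPH N) (θ : Stage13HParams F N)
    (hP : θ.Provisos₁₃CoPH F N) (E : B12.RunParams → ℝ) (hsel : θ.ppSel = ppSelLiveOfRecord F N θ.ν θ.τ9 E (wOfRecord₉ F N θ.toStage9Params))
    (hζm : ZetaMeasurable F N θ.ζ) :
    ForSmallCouplings (datumOfRecord₁₃CoPH F N θ hP) fun g₀ => ∀ os : List (ULoop F),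
      0 < (crGap2₁₃VAt N K₀ jcut ρ ρ' n₁ n₂ F θ hP g₀ os).l₀ ∧ 0 < (crGap2₁₃VAt N K₀ jcut ρ ρ' n₁ n₂ F θ hP g₀ os).vol ∧
      (∀ (K : ℕ) (t : ℝ), |t| ≤ (crGap2₁₃VAt N K₀ jcut ρ ρ' n₁ n₂ F θ hP g₀ os).l₀ →
        T4GenFunBounds.schemeZ ((datumOfRecord₁₃CoPH F N θ hP).scheme g₀) os ((crGap2₁₃VAt N K₀ jcut ρ ρ' n₁ n₂ F θ hP g₀ os).K₀ + K) t =
          ∑ τ ∈ (crGap2₁₃VAt N K₀ jcut ρ ρ' n₁ n₂ F θ hP g₀ os).T K, (crGap2₁₃VAt N K₀ jcut ρ ρ' n₁ n₂ F θ hP g₀ os).A K t τ) ∧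
      (∀ (K : ℕ) (t : ℝ), |t| ≤ (crGap2₁₃VAt N K₀ jcut ρ ρ' n₁ n₂ F θ hP g₀ os).l₀ →
        T4GenFunBounds.schemeZ ((datumOfRecord₁₃CoPH F N θ hP).scheme g₀) os ((crGap2₁₃VAt N K₀ jcut ρ ρ' n₁ n₂ F θ hP g₀ os).K₀ + K + 1) t =
          ∑ τ ∈ (crGap2₁₃VAt N K₀ jcut ρ ρ' n₁ n₂ F θ hP g₀ os).T K, (crGap2₁₃VAt N K₀ jcut ρ ρ' n₁ n₂ F θ hP g₀ os).B K t τ) :=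
  ForSmallCouplings.of_forall fun g₀ os =>
    ⟨one_pos, pow_pos F.side_pos 4, fun K t _ => (sum_classSet₁₃_gapWeight2A₁₃_eq_schemeZ K₀ θ hP g₀ os E hsel hζm _ _ _ _ K t).symm,
      fun K t _ => (sum_classSet₁₃_gapWeight2B₁₃_eq_schemeZ K₀ θ hP g₀ os E hsel hζm _ _ _ _ K t).symm⟩

/-- ★ **N20 AT THE DOUBLY-GAPPED READING FROM ANY WITNESS** (transfer; no estimate). [bookkeeping] -/
theorem relWeightBound_crGap2₁₃VAt (K₀ : ℕ) (jcut : ℕ → ℕ) (ρ ρ' : WidthLetter₁₃CoPH N) (n₁ n₂ : DepthLetter₁₃CoPH N) (θ : Stage13HParams F N)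
    (hP : θ.Provisos₁₃CoPH F N) (g₀ : ℕ → ℝ) (os : List (ULoop F)) {W : ℕ → ℝ}
    (h : RelWeightBound 1 (classSet₁₃ θ K₀ g₀)
      (gapWeight2A₁₃ θ hP K₀ g₀ os (ρ F θ hP g₀ os) (ρ' F θ hP g₀ os) (n₁ F θ hP g₀ os) (n₂ F θ hP g₀ os))
      (gapWeight2B₁₃ θ hP K₀ g₀ os (ρ F θ hP g₀ os) (ρ' F θ hP g₀ os) (n₁ F θ hP g₀ os) (n₂ F θ hP g₀ os)) (badClass₁₃ θ K₀ g₀ jcut) W) :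
    RelWeightBound (crGap2₁₃VAt N K₀ jcut ρ ρ' n₁ n₂ F θ hP g₀ os).l₀ (crGap2₁₃VAt N K₀ jcut ρ ρ' n₁ n₂ F θ hP g₀ os).T (crGap2₁₃VAt N K₀ jcut ρ ρ' n₁ n₂ F θ hP g₀ os).A
      (crGap2₁₃VAt N K₀ jcut ρ ρ' n₁ n₂ F θ hP g₀ os).B (crGap2₁₃VAt N K₀ jcut ρ ρ' n₁ n₂ F θ hP g₀ os).Bad (crGap2₁₃VAt N K₀ jcut ρ ρ' n₁ n₂ F θ hP g₀ os).W :=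
  relWeightBound_wInf h

/-- ★ **N19′'s CORE AND U4′'s SUMMABILITY AT THE DOUBLY-GAPPED READING's OWN RATE FROM ANY WITNESS** (transfer; no estimate).  The cores `A − shA` are the DOUBLY-GAPPED cores:
NO top (3.2) statistic in `(θ_{i⋆+2}, θ_{i⋆})` and NO top (3.3) statistic in `(δ′_{j⋆+2}, δ′_{j⋆})`, in either run — the single-run half of `T4IndicatorShell`'s design (i) for both
background-mediated indicator families of the last 𝐓-step. [bookkeeping] -/
theorem core_crGap2₁₃VAt (K₀ : ℕ) (jcut : ℕ → ℕ) (ρ ρ' : WidthLetter₁₃CoPH N) (n₁ n₂ : DepthLetter₁₃CoPH N) (θ : Stage13HParams F N) (hP : θ.Provisos₁₃CoPH F N)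
    (g₀ : ℕ → ℝ) (os : List (ULoop F)) {δ : ℕ → ℝ}
    (hP0 : letI : DecidableEq (Σ K, SiteSeqKey F (K₀ + K)) := Classical.decEq _
      ∀ (K : ℕ) (t : ℝ), |t| ≤ 1 → ∀ x ∈ classSet₁₃ θ K₀ g₀ K \ badClass₁₃ θ K₀ g₀ jcut K t,
        0 ≤ gapWeight2A₁₃ θ hP K₀ g₀ os (ρ F θ hP g₀ os) (ρ' F θ hP g₀ os) (n₁ F θ hP g₀ os) (n₂ F θ hP g₀ os) K t x -
          gapShell2A₁₃ θ hP K₀ g₀ os (ρ F θ hP g₀ os) (ρ' F θ hP g₀ os) (n₁ F θ hP g₀ os) (n₂ F θ hP g₀ os) K t x)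
    (h : letI : DecidableEq (Σ K, SiteSeqKey F (K₀ + K)) := Classical.decEq _
      NE7.Core 1 (F.side ^ 4) (classSet₁₃ θ K₀ g₀) (badClass₁₃ θ K₀ g₀ jcut)
        (fun K t x => gapWeight2A₁₃ θ hP K₀ g₀ os (ρ F θ hP g₀ os) (ρ' F θ hP g₀ os) (n₁ F θ hP g₀ os) (n₂ F θ hP g₀ os) K t x -
          gapShell2A₁₃ θ hP K₀ g₀ os (ρ F θ hP g₀ os) (ρ' F θ hP g₀ os) (n₁ F θ hP g₀ os) (n₂ F θ hP g₀ os) K t x)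
        (fun K t x => gapWeight2B₁₃ θ hP K₀ g₀ os (ρ F θ hP g₀ os) (ρ' F θ hP g₀ os) (n₁ F θ hP g₀ os) (n₂ F θ hP g₀ os) K t x -
          gapShell2B₁₃ θ hP K₀ g₀ os (ρ F θ hP g₀ os) (ρ' F θ hP g₀ os) (n₁ F θ hP g₀ os) (n₂ F θ hP g₀ os) K t x) δ)
    (hδ : Summable δ) :
    (letI := (crGap2₁₃VAt N K₀ jcut ρ ρ' n₁ n₂ F θ hP g₀ os).dec
     NE7.Core (crGap2₁₃VAt N K₀ jcut ρ ρ' n₁ n₂ F θ hP g₀ os).l₀ (crGap2₁₃VAt N K₀ jcut ρ ρ' n₁ n₂ F θ hP g₀ os).vol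
      (crGap2₁₃VAt N K₀ jcut ρ ρ' n₁ n₂ F θ hP g₀ os).T (crGap2₁₃VAt N K₀ jcut ρ ρ' n₁ n₂ F θ hP g₀ os).Bad
      (fun K t τ => (crGap2₁₃VAt N K₀ jcut ρ ρ' n₁ n₂ F θ hP g₀ os).A K t τ - (crGap2₁₃VAt N K₀ jcut ρ ρ' n₁ n₂ F θ hP g₀ os).shA K t τ)
      (fun K t τ => (crGap2₁₃VAt N K₀ jcut ρ ρ' n₁ n₂ F θ hP g₀ os).B K t τ - (crGap2₁₃VAt N K₀ jcut ρ ρ' n₁ n₂ F θ hP g₀ os).shB K t τ)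
      (crGap2₁₃VAt N K₀ jcut ρ ρ' n₁ n₂ F θ hP g₀ os).δ) ∧ Summable (crGap2₁₃VAt N K₀ jcut ρ ρ' n₁ n₂ F θ hP g₀ os).δ := by
  letI : DecidableEq (Σ K, SiteSeqKey F (K₀ + K)) := Classical.decEq _
  letI := (crGap2₁₃VAt N K₀ jcut ρ ρ' n₁ n₂ F θ hP g₀ os).dec
  exact ⟨core_deltaCan (pow_pos F.side_pos 4).le hP0 h, summable_deltaCan (pow_pos F.side_pos 4).le hP0 h hδ⟩

/-- **U4′'s `W + Wsh < 1` AT THE DOUBLY-GAPPED READING FROM ANY WITNESSES** (transfer). [bookkeeping] -/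
theorem lt_one_crGap2₁₃VAt (K₀ : ℕ) (jcut : ℕ → ℕ) (ρ ρ' : WidthLetter₁₃CoPH N) (n₁ n₂ : DepthLetter₁₃CoPH N) (θ : Stage13HParams F N)
    (hP : θ.Provisos₁₃CoPH F N) (g₀ : ℕ → ℝ) (os : List (ULoop F)) {W Wsh : ℕ → ℝ}
    (hW : RelWeightBound 1 (classSet₁₃ θ K₀ g₀)
      (gapWeight2A₁₃ θ hP K₀ g₀ os (ρ F θ hP g₀ os) (ρ' F θ hP g₀ os) (n₁ F θ hP g₀ os) (n₂ F θ hP g₀ os))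
      (gapWeight2B₁₃ θ hP K₀ g₀ os (ρ F θ hP g₀ os) (ρ' F θ hP g₀ os) (n₁ F θ hP g₀ os) (n₂ F θ hP g₀ os)) (badClass₁₃ θ K₀ g₀ jcut) W)
    (hSh : ShellWeightBound 1 (classSet₁₃ θ K₀ g₀)
      (gapWeight2A₁₃ θ hP K₀ g₀ os (ρ F θ hP g₀ os) (ρ' F θ hP g₀ os) (n₁ F θ hP g₀ os) (n₂ F θ hP g₀ os))
      (gapWeight2B₁₃ θ hP K₀ g₀ os (ρ F θ hP g₀ os) (ρ' F θ hP g₀ os) (n₁ F θ hP g₀ os) (n₂ F θ hP g₀ os))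
      (gapShell2A₁₃ θ hP K₀ g₀ os (ρ F θ hP g₀ os) (ρ' F θ hP g₀ os) (n₁ F θ hP g₀ os) (n₂ F θ hP g₀ os))
      (gapShell2B₁₃ θ hP K₀ g₀ os (ρ F θ hP g₀ os) (ρ' F θ hP g₀ os) (n₁ F θ hP g₀ os) (n₂ F θ hP g₀ os)) Wsh)
    (hlt : ∀ K, W K + Wsh K < 1) (K : ℕ) :
    (crGap2₁₃VAt N K₀ jcut ρ ρ' n₁ n₂ F θ hP g₀ os).W K + (crGap2₁₃VAt N K₀ jcut ρ ρ' n₁ n₂ F θ hP g₀ os).Wsh K < 1 :=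
  wInf_add_wshInf_lt_one hW hSh hlt K

/-- ★★ **THE K3 STUB-2 CONJUNCT `KeyedShellWeight` AT `crGap2₁₃V`, IN THE SKELETON's ∀-SHAPE, MODULO THE DISPLAYED ROWS** (live-selector pin, (H-ζ), the dial rows, the tops'
`0 ≤ ε`, the old levels' `0 ≤ δ`, `Σ_K (1∕(n₁ K+1) + 1∕(n₂ K+1)) < ∞`) — the record object `crGap2₁₃V = crGap2₁₃VAt N 0` (`rfl`). [bookkeeping] -/
theorem keyedShellWeight_shape_crGap2₁₃V_of_rows (jcut : ℕ → ℕ) (ρ ρ' : WidthLetter₁₃CoPH N) (n₁ n₂ : DepthLetter₁₃CoPH N)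
    (E : (F : T4Family) → Stage13HParams F N → (B12.RunParams → ℝ)) :
    ∀ (F : T4Family) (θ : Stage13HParams F N) (hP : θ.Provisos₁₃CoPH F N),
      θ.ppSel = ppSelLiveOfRecord F N θ.ν θ.τ9 (E F θ) (wOfRecord₉ F N θ.toStage9Params) → ZetaMeasurable F N θ.ζ →
      ∀ (g₀ : ℕ → ℝ) (os : List (ULoop F)),
        (∀ K, 0 ≤ ρ F θ hP g₀ os K) → (∀ K, ρ F θ hP g₀ os K ≤ 1) → (∀ K, 0 ≤ ρ' F θ hP g₀ os K) → (∀ K, ρ' F θ hP g₀ os K ≤ 1) →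
        (∀ K, 0 ≤ epsOfRecord θ.ν (histA₁₃ θ 0 g₀ K) (0 + K)) → (∀ K, 0 ≤ epsOfRecord θ.ν (histB₁₃ θ 0 g₀ K) (0 + K + 1)) →
        (∀ K, 0 ≤ deltaOfRecord θ.ν (histA₁₃ θ 0 g₀ K) (0 + K - 1) θ.A₁) → (∀ K, 0 ≤ deltaOfRecord θ.ν (histB₁₃ θ 0 g₀ K) (0 + K) θ.A₁) →
        Summable (fun K => 1 / ((n₁ F θ hP g₀ os K : ℝ) + 1) + 1 / ((n₂ F θ hP g₀ os K : ℝ) + 1)) →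
        ShellWeightBound (crGap2₁₃V N jcut ρ ρ' n₁ n₂ F θ hP g₀ os).l₀ (crGap2₁₃V N jcut ρ ρ' n₁ n₂ F θ hP g₀ os).T (crGap2₁₃V N jcut ρ ρ' n₁ n₂ F θ hP g₀ os).A
          (crGap2₁₃V N jcut ρ ρ' n₁ n₂ F θ hP g₀ os).B (crGap2₁₃V N jcut ρ ρ' n₁ n₂ F θ hP g₀ os).shA (crGap2₁₃V N jcut ρ ρ' n₁ n₂ F θ hP g₀ os).shB
          (crGap2₁₃V N jcut ρ ρ' n₁ n₂ F θ hP g₀ os).Wsh :=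
  fun F θ hP hsel hζm g₀ os hρ0 hρ1 hρ'0 hρ'1 hεA hεB hδA hδB hn =>
    shellWeightBound_crGap2₁₃VAt 0 jcut ρ ρ' n₁ n₂ θ hP g₀ os (E F θ) hsel hζm hρ0 hρ1 hρ'0 hρ'1 hεA hεB hδA hδB hn

end Faces2

end Summit.QuantumFields.YangMills.Theorems.N21GappedTopPair13CoPH

end
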